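import Summits.BirchSwinnertonDyer.BirchSwinnertonDyer.Theorems.GenusKolyvaginAtTwoTorsionCellSELNegTwistSurj
import Summits.BirchSwinnertonDyer.BirchSwinnertonDyer.Theorems.GenusKolyvaginAtTwoTorsionCellSELNegTwistParamMem
import Summits.BirchSwinnertonDyer.BirchSwinnertonDyer.Theorems.GenusKolyvaginAtTwoTorsionCellSELBorderedSolCount
import Summits.BirchSwinnertonDyer.BirchSwinnertonDyer.Theorems.GenusKolyvaginAtTwoTorsionCellSELTwistParam
import HarnessLib

/-!
# SEL (iso-class Selmer pair law), C1-Q: `#Sel₂(E^{(−p₀M)}) = 8 · #ker Φ₃(B)` — the `C₁` count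

Crux R″ `RankOneTwoTorsionResidualAtTwo` (stmt-27478), LINE 49 «full_vertex», SUPPORT stub SEL
`IsoClassSelmerPairLawAtTwo`, the `C₁` half (LEAD memo `Cruxes/…/Lines/torsion_cell_full_vertex_SEL_C1_road_g36.md`).
**`natCard_selmerGroup_negTwist_isoClass_eq`**: for `E/ℚ` with full rational `2`-torsion, rank `0`, `Ш[2] = 0`,
root differences units off `S ∋ 2`, good reduction off `S`; `Q` a non-empty even set of iso-class full-admissible primes
`≡ 3 (mod 4)` outside `S` with common bit `ε`; `p₀ ≡ 7 (mod 8)` outside `S ∪ Q` with `−p₀` a square at the places of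
`S` and the positive root differences squares mod `p₀`; `d = −p₀ ∏_{q∈Q} q`:
`#Sel⁽²⁾(E^{(d)}/ℚ) = 8 · #ker Φ₃(B)`, `B = borderedLaplacian Q p₀`, `Φ₃(t) = t² + t + 1`.
Proof: `Ψ(σ, τ, γ, χ) = c_{E^{(d)}}(w₁^σ t₁(τ) (−p₀)^{γ₁} ∏_{χ₁} q, …)` is a bijection from the solutions of `SysC1`
(part C1-D: `8·#ker Φ₃(B)` of them) onto the Selmer group (parts C1-N, C1-O and the bits).  Everything is proved; no LINE 49 statement is restated; BSD is not advanced by this file alone.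

## References

* [KlagsbrunMazurRubin2013] Z. Klagsbrun, B. Mazur, K. Rubin, Ann. of Math. 178 (2013), Thm. 3.9.
* [Kane2013SelmerTwists] D. M. Kane, Algebra Number Theory 7 (2013), §2.
* [HeathBrown1994SelmerCongruentII] D. R. Heath-Brown, Invent. Math. 118 (1994), §2.
* [SilvermanAEC2009] J. H. Silverman, *The Arithmetic of Elliptic Curves*, 2nd ed., Prop. X.1.4, Prop. X.4.9.
-/

noncomputable section

open scoped Classical

namespace Summit.BirchSwinnertonDyer.BirchSwinnertonDyer.Theorems.GenusKolyvaginAtTwo.TorsionCellSEL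

open WeierstrassCurve WeierstrassCurve.Affine WeierstrassCurve.Affine.Point
open Literature.NumberTheory.GaloisRepresentations Literature.NumberTheory.EllipticCurves Field
open Literature.NumberTheory.EllipticCurves.TwoDescentLocal
open Literature.NumberTheory.EllipticCurves.KramerTwoDescent
open Literature.NumberTheory.QuadraticForms
open Summit.BirchSwinnertonDyer.BirchSwinnertonDyer.Theorems.GenusKolyvaginAtTwo.TorsionCellD0
open Summit.BirchSwinnertonDyer.BirchSwinnertonDyer.Theorems.GenusKolyvaginAtTwo.FullVertex
open IsDedekindDomain NumberField Rat.HeightOneSpectrum Matrix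

variable (E : WeierstrassCurve ℚ) [E.IsElliptic] {e₁ e₂ e₃ : ℚ} (S Q : Finset ℕ) {p₀ : ℕ} [hp₀ : Fact p₀.Prime]

omit hp₀ in
/-- `𝔽₂`: `(τ₁+ετ₂, (1+ε)τ₁+τ₂)` determines `(τ₁, τ₂)`. [folklore] -/
private theorem zmod2_tau (ε a b a' b' : ZMod 2) (h1 : a + ε * b = a' + ε * b') (h2 : (1 + ε) * a + b = (1 + ε) * a' + b') :
    a = a' ∧ b = b' := by
  revert ε a b a' b' h1 h2; decide

omit hp₀ in
/-- `𝔽₂`: cancel a common summand. [folklore] -/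
private theorem zmod2_cancel (a b c : ZMod 2) (h : a + c = b + c) : a = b := by
  revert a b c h; decide

/-- **THE `C₁` COUNT** (see the module docstring). [cite: KlagsbrunMazurRubin2013, Thm. 3.9] [cite: Kane2013SelmerTwists, §2]
[cite: HeathBrown1994SelmerCongruentII, §2] [cite: SilvermanAEC2009, Prop. X.1.4, Prop. X.4.9] -/
theorem natCard_selmerGroup_negTwist_isoClass_eq (h : E.toAffine.SplitTwoTorsion e₁ e₂ e₃) (h12 : e₁ < e₂) (h23 : e₂ < e₃)
    (hS : ∀ ℓ ∈ S, ℓ.Prime) (h2S : 2 ∈ S)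
    (hgood : ∀ ℓ : ℕ, (hℓ : ℓ.Prime) → ℓ ∉ S → haveI : Fact ℓ.Prime := ⟨hℓ⟩;
      padicValRat ℓ (e₁ - e₂) = 0 ∧ padicValRat ℓ (e₁ - e₃) = 0 ∧ padicValRat ℓ (e₂ - e₃) = 0)
    (hN : ∀ ℓ : ℕ, ℓ.Prime → ℓ ∉ S → ¬ ℓ ∣ E.conductorNorm ℤ)
    (hrank : E.mordellWeilRank = 0) (hsha : ∀ x ∈ E.sha, (2 : ℕ) • x = 0 → x = 0)
    (hQ : ∀ q ∈ Q, q.Prime) (hQS : ∀ q ∈ Q, q ∉ S) (hQ4 : ∀ q ∈ Q, q % 4 = 3) (hk : Even Q.card)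
    {q₀ : ℕ} (hq₀ : q₀ ∈ Q)
    (hiso8 : ∀ q ∈ Q, ∀ q' ∈ Q, q % 8 = q' % 8)
    (hisoS : ∀ q ∈ Q, ∀ q' ∈ Q, ∀ ℓ ∈ S, (hℓ : ℓ.Prime) → ℓ ≠ 2 → haveI : Fact ℓ.Prime := ⟨hℓ⟩;
      legendreSym ℓ ((q : ℤ) * q') = 1)
    (hadm : ∀ q ∈ Q, (hq : q.Prime) → haveI : Fact q.Prime := ⟨hq⟩;
      qrBit q ((e₁ - e₂) * (e₁ - e₃)) = 1 ∧ qrBit q ((e₂ - e₁) * (e₂ - e₃)) = 1)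
    {ε : ZMod 2} (hε : ∀ q ∈ Q, (hq : q.Prime) → haveI : Fact q.Prime := ⟨hq⟩; qrBit q (e₂ - e₁) = ε)
    (hp₀S : p₀ ∉ S) (hp₀Q : p₀ ∉ Q) (hp8 : p₀ % 8 = 7)
    (hsplitp : ∀ ℓ ∈ S, (hℓ : ℓ.Prime) → ℓ ≠ 2 → haveI : Fact ℓ.Prime := ⟨hℓ⟩; legendreSym ℓ (-(p₀ : ℤ)) = 1)
    (hres₀ : qrBit p₀ (e₂ - e₁) = 0 ∧ qrBit p₀ (e₃ - e₁) = 0 ∧ qrBit p₀ (e₃ - e₂) = 0)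
    {d : ℚ} (hd : d = -(p₀ : ℚ) * ∏ q ∈ Q, (q : ℚ)) [(E.quadraticTwist d).IsElliptic] :
    Nat.card (selmerGroup (E.quadraticTwist d) 2) = 8 * Nat.card (LinearMap.ker (phi3 (borderedLaplacian Q p₀)).mulVecLin) := by
  classical
  haveI hq₀F : Fact q₀.Prime := ⟨hQ q₀ hq₀⟩
  have h' := h.quadraticTwist d
  have hp4 : p₀ % 4 = 3 := by omega
  have hQ0 : ∀ q ∈ Q, (q : ℚ) ≠ 0 := fun q hq => by exact_mod_cast (hQ q hq).ne_zero
  have he12 : e₁ - e₂ ≠ 0 := sub_ne_zero.mpr h.ne₁₂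
  have he21 : e₂ - e₁ ≠ 0 := sub_ne_zero.mpr h.ne₁₂.symm
  have he13 : e₁ - e₃ ≠ 0 := sub_ne_zero.mpr h.ne₁₃
  have he31 : e₃ - e₁ ≠ 0 := sub_ne_zero.mpr h.ne₁₃.symm
  have he23 : e₂ - e₃ ≠ 0 := sub_ne_zero.mpr h.ne₂₃
  have he32 : e₃ - e₂ ≠ 0 := sub_ne_zero.mpr h.ne₂₃.symm
  have hz2 : ∀ x : ZMod 2, x = 0 ∨ x = 1 := by decide
  -- residue facts at `p₀` in the four-fact form
  obtain ⟨r21, r31, r32⟩ := hres₀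
  have hm1p : qrBit p₀ (-1 : ℚ) = 1 := qrBit_neg_one_eq_one_of_emod_four hp4
  have r12 : qrBit p₀ (e₁ - e₂) = 1 := by rw [← neg_sub, qrBit_neg (p := p₀) he21, hm1p, r21, add_zero]
  have r13 : qrBit p₀ (e₁ - e₃) = 1 := by rw [← neg_sub, qrBit_neg (p := p₀) he31, hm1p, r31, add_zero]
  have r23 : qrBit p₀ (e₂ - e₃) = 1 := by rw [← neg_sub, qrBit_neg (p := p₀) he32, hm1p, r32, add_zero]
  have hres₀4 : qrBit p₀ (e₂ - e₁) = 0 ∧ qrBit p₀ (e₁ - e₂) = 1 ∧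
      qrBit p₀ ((e₁ - e₂) * (e₁ - e₃)) = 0 ∧ qrBit p₀ ((e₂ - e₁) * (e₂ - e₃)) = 1 :=
    ⟨r21, r12, by rw [qrBit_mul p₀ he12 he13, r12, r13]; decide, by rw [qrBit_mul p₀ he21 he23, r21, r23, zero_add]⟩
  -- the base pair, torsion units, twisting factors, indicator sets
  obtain ⟨w₁, w₂, hwpar, hwres, hwp₁, hwp₂, hws₁, hws₂, hwrel⟩ := exists_negTwist_base E S Q h h12 h23 hS h2S hgood hN hrank
    hsha hQ hQS hQ4 hq₀ hiso8 hisoS (hadm q₀ hq₀ hq₀F.out).1 (hadm q₀ hq₀ hq₀F.out).2 (hε q₀ hq₀ hq₀F.out) hp₀S hp₀Q hp8 hsplitp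
  choose T₁ T₂ hT using fun τ₁ τ₂ : ZMod 2 => exists_torsionUnits E S Q h h12 h23 hgood hQ4 hadm hε hp4 ⟨r21, r31, r32⟩ τ₁ τ₂
  choose X hX using fun γ : ZMod 2 => exists_twistUnit Q hp₀Q hp4 γ
  obtain ⟨As, hAs_sub, hAs_ind⟩ : ∃ As : (Q → ZMod 2) → Finset ℕ,
      (∀ χ, As χ ⊆ Q) ∧ ∀ χ (i : Q), χ i = (if (i : ℕ) ∈ As χ then 1 else 0) :=
    ⟨fun χ => Classical.choose (exists_finset_of_indicator Q χ),
      fun χ => (Classical.choose_spec (exists_finset_of_indicator Q χ)).1,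
      fun χ => (Classical.choose_spec (exists_finset_of_indicator Q χ)).2⟩
  have hprod : ∀ χ, ∏ i ∈ As χ, (i : ℚ) ≠ 0 := fun χ => Finset.prod_ne_zero_iff.mpr fun i hi => hQ0 i (hAs_sub χ hi)
  have hAs_eq : ∀ χ {A : Finset ℕ}, A ⊆ Q → (∀ i : Q, χ i = (if (i : ℕ) ∈ A then 1 else 0)) → As χ = A :=
    fun χ A hA hind => finset_eq_of_indicator_eq Q (hAs_sub χ) hA fun i => by rw [← hAs_ind χ i, hind i]
  have hAs_card : ∀ χ : Q → ZMod 2, ∑ i : Q, χ i = ((As χ).card : ZMod 2) := fun χ => by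
    rw [Finset.sum_congr rfl (fun i _ => hAs_ind χ i)]; exact sum_indicator_eq_card Q (hAs_sub χ)
  obtain ⟨W₁, hW₁⟩ : ∃ W₁ : ZMod 2 → ℚˣ, ∀ σ, W₁ σ = if σ = 1 then w₁ else 1 := ⟨_, fun _ => rfl⟩
  obtain ⟨W₂, hW₂⟩ : ∃ W₂ : ZMod 2 → ℚˣ, ∀ σ, W₂ σ = if σ = 1 then w₂ else 1 := ⟨_, fun _ => rfl⟩
  have hpar1 : ∀ (ℓ : ℕ) [Fact ℓ.Prime], parityBit ℓ ((1 : ℚˣ) : ℚ) = 0 := fun ℓ _ => by simp [parityBit]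
  have hsign1 : signBit ((1 : ℚˣ) : ℚ) = 0 := (signBit_eq_zero_iff one_ne_zero).mpr one_pos
  have hWbits : ∀ σ, (∀ ℓ : ℕ, (hℓ : ℓ.Prime) → ℓ ∉ S → haveI : Fact ℓ.Prime := ⟨hℓ⟩;
        parityBit ℓ (W₁ σ : ℚ) = 0 ∧ parityBit ℓ (W₂ σ : ℚ) = 0) ∧
      (∀ j ∈ Q, (hj : j.Prime) → haveI : Fact j.Prime := ⟨hj⟩; qrBit j (W₁ σ : ℚ) = 0 ∧ qrBit j (W₂ σ : ℚ) = 0) ∧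
      (qrBit p₀ (W₁ σ : ℚ) = σ ∧ qrBit p₀ (W₂ σ : ℚ) = 0) ∧ (signBit (W₁ σ : ℚ) = σ ∧ signBit (W₂ σ : ℚ) = 0) := by
    intro σ
    rcases hz2 σ with e | e <;> subst e
    · simp only [hW₁, hW₂, if_neg (zero_ne_one : (0 : ZMod 2) ≠ 1)]
      refine ⟨fun ℓ hℓ _ => ?_, fun j hj hjp => ?_, ⟨qrBit_one, qrBit_one⟩, ⟨hsign1, hsign1⟩⟩
      · haveI : Fact ℓ.Prime := ⟨hℓ⟩; exact ⟨hpar1 ℓ, hpar1 ℓ⟩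
      · haveI : Fact j.Prime := ⟨hjp⟩; exact ⟨qrBit_one, qrBit_one⟩
    · simp only [hW₁, hW₂]
      exact ⟨hwpar, hwres, ⟨hwp₁, hwp₂⟩, ⟨hws₁, hws₂⟩⟩
  have hWrel : ∀ (σ : ZMod 2) (A₁ A₂ : Finset ℕ), A₁ ⊆ Q → A₂ ⊆ Q →
      (A₁.card : ZMod 2) = (1 + ε) * σ → (A₂.card : ZMod 2) = ε * σ →
      ∀ (hp₁ : ∏ i ∈ A₁, (i : ℚ) ≠ 0) (hp₂ : ∏ i ∈ A₂, (i : ℚ) ≠ 0), ∀ v : HeightOneSpectrum (𝓞 ℚ), natGenerator v ∈ S →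
        E.twoDescentClass h (W₁ σ * Units.mk0 _ hp₁) (W₂ σ * Units.mk0 _ hp₂) ∈ selmerLocalKer E (v.adicCompletion ℚ) 2 := by
    intro σ A₁ A₂ hA₁ hA₂ hc₁ hc₂ hp₁ hp₂ v hvS
    rcases hz2 σ with e | e <;> subst e
    · rw [mul_zero] at hc₁ hc₂
      simp only [hW₁, hW₂, if_neg (zero_ne_one : (0 : ZMod 2) ≠ 1), one_mul]
      exact twoDescentClass_mem_selmerLocalKer_of_isSquare E h _ (charZero_of_injective_algebraMap (algebraMap ℚ _).injective)
        _ _ (isSquare_prod_adicCompletion_of_isoClass S Q hQ hQS hQ4 hiso8 hisoS hA₁ ((ZMod.natCast_eq_zero_iff_even).mp hc₁) v hvS)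
        (isSquare_prod_adicCompletion_of_isoClass S Q hQ hQS hQ4 hiso8 hisoS hA₂ ((ZMod.natCast_eq_zero_iff_even).mp hc₂) v hvS)
    · rw [mul_one] at hc₁ hc₂
      simp only [hW₁, hW₂]
      exact hwrel A₁ A₂ hA₁ hA₂ hc₁ hc₂ hp₁ hp₂ v hvS
  -- the class map
  obtain ⟨cls, hcls⟩ : ∃ cls : (ZMod 2 × ZMod 2 × ZMod 2 × ZMod 2 × ZMod 2) × ((Q → ZMod 2) × (Q → ZMod 2)) →
      galH1Torsion (E.quadraticTwist d) 2, ∀ x, cls x = (E.quadraticTwist d).twoDescentClass h'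
        ((W₁ x.1.1 * Units.mk0 _ (hprod x.2.1)) * (T₁ x.1.2.1 x.1.2.2.1 * X x.1.2.2.2.1))
        ((W₂ x.1.1 * Units.mk0 _ (hprod x.2.2)) * (T₂ x.1.2.1 x.1.2.2.1 * X x.1.2.2.2.2)) := ⟨_, fun _ => rfl⟩
  -- bits of the parametrised units needed for injectivity
  have hUbits : ∀ (σ τ₁ τ₂ γ : ZMod 2) (χ : Q → ZMod 2),
      (∀ j : Q, haveI : Fact (j : ℕ).Prime := ⟨hQ j j.2⟩;
        parityBit j (((W₁ σ * Units.mk0 _ (hprod χ)) * (T₁ τ₁ τ₂ * X γ) : ℚˣ) : ℚ) = χ j ∧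
        parityBit j (((W₂ σ * Units.mk0 _ (hprod χ)) * (T₂ τ₁ τ₂ * X γ) : ℚˣ) : ℚ) = χ j) ∧
      parityBit p₀ (((W₁ σ * Units.mk0 _ (hprod χ)) * (T₁ τ₁ τ₂ * X γ) : ℚˣ) : ℚ) = γ ∧
      parityBit p₀ (((W₂ σ * Units.mk0 _ (hprod χ)) * (T₂ τ₁ τ₂ * X γ) : ℚˣ) : ℚ) = γ ∧
      signBit (((W₁ σ * Units.mk0 _ (hprod χ)) * (T₁ τ₁ τ₂ * X γ) : ℚˣ) : ℚ) = σ + γ ∧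
      signBit (((W₂ σ * Units.mk0 _ (hprod χ)) * (T₂ τ₁ τ₂ * X γ) : ℚˣ) : ℚ) = τ₁ + τ₂ + γ ∧
      qrBit q₀ (((W₁ σ * Units.mk0 _ (hprod χ)) * (T₁ τ₁ τ₂ * X γ) : ℚˣ) : ℚ) =
        τ₁ + ε * τ₂ + γ * (if jacobiSym (-(p₀ : ℤ)) q₀ = -1 then (1 : ZMod 2) else 0) + qrBit q₀ (∏ i ∈ As χ, (i : ℚ)) ∧
      qrBit q₀ (((W₂ σ * Units.mk0 _ (hprod χ)) * (T₂ τ₁ τ₂ * X γ) : ℚˣ) : ℚ) =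
        (1 + ε) * τ₁ + τ₂ + γ * (if jacobiSym (-(p₀ : ℤ)) q₀ = -1 then (1 : ZMod 2) else 0) + qrBit q₀ (∏ i ∈ As χ, (i : ℚ)) := by
    intro σ τ₁ τ₂ γ χ
    obtain ⟨hWpar, hWQ, hWp, hWs⟩ := hWbits σ
    obtain ⟨-, -, hTpar, hTQ, hTp1, hTp2, hTs1, hTs2⟩ := hT τ₁ τ₂
    obtain ⟨-, hXpar, hXp, hXQ, hXp₀, hXs⟩ := hX γ
    have hAp : ∀ i ∈ As χ, i.Prime := fun i hi => hQ i (hAs_sub χ hi)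
    have hsP : signBit (∏ i ∈ As χ, (i : ℚ)) = 0 :=
      (signBit_eq_zero_iff (hprod χ)).mpr (Finset.prod_pos fun i hi => by exact_mod_cast (hAp i hi).pos)
    have nz := fun (u : ℚˣ) => u.ne_zero
    refine ⟨fun j => ?_, ?_, ?_, ?_, ?_, ?_, ?_⟩
    · haveI : Fact (j : ℕ).Prime := ⟨hQ j j.2⟩
      have hjS : (j : ℕ) ∉ S := hQS j j.2
      have hjp₀ : (j : ℕ) ≠ p₀ := fun e => hp₀Q (e ▸ j.2)
      simp only [Units.val_mul, Units.val_mk0]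
      rw [parityBit_mul (mul_ne_zero (nz _) (hprod χ)) (mul_ne_zero (nz _) (nz _)), parityBit_mul (nz _) (hprod χ),
        parityBit_mul (nz _) (nz _), parityBit_mul (mul_ne_zero (nz _) (hprod χ)) (mul_ne_zero (nz _) (nz _)),
        parityBit_mul (nz _) (hprod χ), parityBit_mul (nz _) (nz _), (hWpar j (hQ j j.2) hjS).1, (hWpar j (hQ j j.2) hjS).2,
        (hTpar j (hQ j j.2) hjS).1, (hTpar j (hQ j j.2) hjS).2, (hXpar j (hQ j j.2) hjp₀), parityBit_prod_primes hAp,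
        ← hAs_ind χ j]
      constructor <;> ring
    · simp only [Units.val_mul, Units.val_mk0]
      rw [parityBit_mul (mul_ne_zero (nz _) (hprod χ)) (mul_ne_zero (nz _) (nz _)), parityBit_mul (nz _) (hprod χ),
        parityBit_mul (nz _) (nz _), (hWpar p₀ hp₀.out hp₀S).1, (hTpar p₀ hp₀.out hp₀S).1, hXp, parityBit_prod_primes hAp,
        if_neg (fun e => hp₀Q (hAs_sub χ e))]
      ring
    · simp only [Units.val_mul, Units.val_mk0]
      rw [parityBit_mul (mul_ne_zero (nz _) (hprod χ)) (mul_ne_zero (nz _) (nz _)), parityBit_mul (nz _) (hprod χ),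
        parityBit_mul (nz _) (nz _), (hWpar p₀ hp₀.out hp₀S).2, (hTpar p₀ hp₀.out hp₀S).2, hXp, parityBit_prod_primes hAp,
        if_neg (fun e => hp₀Q (hAs_sub χ e))]
      ring
    · simp only [Units.val_mul, Units.val_mk0]
      rw [signBit_mul (mul_ne_zero (nz _) (hprod χ)) (mul_ne_zero (nz _) (nz _)), signBit_mul (nz _) (hprod χ),
        signBit_mul (nz _) (nz _), hWs.1, hTs1, hXs, hsP]
      ring
    · simp only [Units.val_mul, Units.val_mk0]
      rw [signBit_mul (mul_ne_zero (nz _) (hprod χ)) (mul_ne_zero (nz _) (nz _)), signBit_mul (nz _) (hprod χ),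
        signBit_mul (nz _) (nz _), hWs.2, hTs2, hXs, hsP]
      ring
    · simp only [Units.val_mul, Units.val_mk0]
      rw [qrBit_mul q₀ (mul_ne_zero (nz _) (hprod χ)) (mul_ne_zero (nz _) (nz _)), qrBit_mul q₀ (nz _) (hprod χ),
        qrBit_mul q₀ (nz _) (nz _), (hWQ q₀ hq₀ hq₀F.out).1, (hTQ q₀ hq₀ hq₀F.out).1, hXQ q₀ hq₀ hq₀F.out]
      ring
    · simp only [Units.val_mul, Units.val_mk0]
      rw [qrBit_mul q₀ (mul_ne_zero (nz _) (hprod χ)) (mul_ne_zero (nz _) (nz _)), qrBit_mul q₀ (nz _) (hprod χ),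
        qrBit_mul q₀ (nz _) (nz _), (hWQ q₀ hq₀ hq₀F.out).2, (hTQ q₀ hq₀ hq₀F.out).2, hXQ q₀ hq₀ hq₀F.out]
      ring
  -- equal torsion / twisting units from equal `τ` / `γ` data
  have hTeq : ∀ (τ₁ τ₂ : ZMod 2) (t₁ t₂ : ℚˣ),
      ((τ₁ = 0 ∧ τ₂ = 0 ∧ (t₁ : ℚ) = 1 ∧ (t₂ : ℚ) = 1) ∨
        (τ₁ = 1 ∧ τ₂ = 0 ∧ (t₁ : ℚ) = (e₁ - e₂) * (e₁ - e₃) ∧ (t₂ : ℚ) = e₁ - e₂) ∨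
        (τ₁ = 0 ∧ τ₂ = 1 ∧ (t₁ : ℚ) = e₂ - e₁ ∧ (t₂ : ℚ) = (e₂ - e₁) * (e₂ - e₃)) ∨
        (τ₁ = 1 ∧ τ₂ = 1 ∧ (t₁ : ℚ) = e₃ - e₁ ∧ (t₂ : ℚ) = e₃ - e₂)) → T₁ τ₁ τ₂ = t₁ ∧ T₂ τ₁ τ₂ = t₂ := by
    intro τ₁ τ₂ t₁ t₂ htv
    rcases htv with ⟨e1, e2, v1, v2⟩ | ⟨e1, e2, v1, v2⟩ | ⟨e1, e2, v1, v2⟩ | ⟨e1, e2, v1, v2⟩ <;> subst e1 e2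
    · rcases (hT 0 0).1 with ⟨-, -, u1, u2⟩ | ⟨h1, -⟩ | ⟨-, h1, -⟩ | ⟨h1, -⟩
      · exact ⟨Units.ext (u1.trans v1.symm), Units.ext (u2.trans v2.symm)⟩
      all_goals exact absurd h1 zero_ne_one
    · rcases (hT 1 0).1 with ⟨h1, -⟩ | ⟨-, -, u1, u2⟩ | ⟨h1, -⟩ | ⟨-, h1, -⟩
      · exact absurd h1 one_ne_zero
      · exact ⟨Units.ext (u1.trans v1.symm), Units.ext (u2.trans v2.symm)⟩
      · exact absurd h1 one_ne_zero
      · exact absurd h1 zero_ne_one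
    · rcases (hT 0 1).1 with ⟨-, h1, -⟩ | ⟨h1, -⟩ | ⟨-, -, u1, u2⟩ | ⟨h1, -⟩
      · exact absurd h1 one_ne_zero
      · exact absurd h1 zero_ne_one
      · exact ⟨Units.ext (u1.trans v1.symm), Units.ext (u2.trans v2.symm)⟩
      · exact absurd h1 zero_ne_one
    · rcases (hT 1 1).1 with ⟨h1, -⟩ | ⟨-, h1, -⟩ | ⟨h1, -⟩ | ⟨-, -, u1, u2⟩
      · exact absurd h1 one_ne_zero
      · exact absurd h1 one_ne_zero
      · exact absurd h1 one_ne_zero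
      · exact ⟨Units.ext (u1.trans v1.symm), Units.ext (u2.trans v2.symm)⟩
  have hXeq : ∀ (γ : ZMod 2) (Xu : ℚˣ), ((γ = 0 ∧ (Xu : ℚ) = 1) ∨ (γ = 1 ∧ (Xu : ℚ) = -(p₀ : ℚ))) → X γ = Xu := by
    intro γ Xu hXu
    rcases hXu with ⟨e, v⟩ | ⟨e, v⟩ <;> subst e
    · rcases (hX 0).1 with ⟨-, u⟩ | ⟨h1, -⟩
      · exact Units.ext (u.trans v.symm)
      · exact absurd h1 zero_ne_one
    · rcases (hX 1).1 with ⟨h1, -⟩ | ⟨-, u⟩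
      · exact absurd h1 one_ne_zero
      · exact Units.ext (u.trans v.symm)
  have hXv : ∀ γ : ZMod 2, (X γ : ℚ) = 1 ∨ (X γ : ℚ) = -(p₀ : ℚ) := fun γ => by
    rcases (hX γ).1 with ⟨-, u⟩ | ⟨-, u⟩
    exacts [Or.inl u, Or.inr u]
  -- the unified system
  set Sys : (ZMod 2 × ZMod 2 × ZMod 2 × ZMod 2 × ZMod 2) × ((Q → ZMod 2) × (Q → ZMod 2)) → Prop := fun x =>
      (∀ j : Q, (borderedLaplacian Q p₀ *ᵥ x.2.1) j + ε * x.2.1 j + x.2.2 j =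
          x.1.2.2.2.1 * legendreBit (-(p₀ : ℤ)) (j : ℕ) + (x.1.2.1 + ε * x.1.2.2.1 + ∑ i : Q, x.2.1 i)) ∧
      (∀ j : Q, (borderedLaplacian Q p₀ *ᵥ x.2.2) j + (ε + 1) * x.2.2 j + x.2.1 j =
          x.1.2.2.2.2 * legendreBit (-(p₀ : ℤ)) (j : ℕ) + ((ε + 1) * x.1.2.1 + x.1.2.2.1 + ∑ i : Q, x.2.2 i)) ∧
      (∑ j : Q, legendreBit (-(p₀ : ℤ)) (j : ℕ) * x.2.1 j + (∑ j : Q, legendreBit (-(p₀ : ℤ)) (j : ℕ)) * x.1.2.2.2.1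
          = x.1.1) ∧
      (∑ j : Q, legendreBit (-(p₀ : ℤ)) (j : ℕ) * x.2.2 j + (∑ j : Q, legendreBit (-(p₀ : ℤ)) (j : ℕ)) * x.1.2.2.2.2 +
          x.1.2.2.2.2 + x.1.2.2.2.1 + x.1.2.1 + x.1.2.2.1 = 0) ∧
      (x.1.2.2.2.1 + x.1.2.2.2.2 + x.1.2.1 + x.1.2.2.1 = x.1.1) with hSys
  -- (1) solutions give Selmer classes
  have hmem : ∀ x, Sys x → cls x ∈ selmerGroup (E.quadraticTwist d) 2 := by
    rintro ⟨⟨σ, τ₁, τ₂, γ₁, γ₂⟩, ⟨χ₁, χ₂⟩⟩ ⟨hQa, hQb, hPa, hPb, hinf⟩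
    dsimp only at hQa hQb hPa hPb hinf
    rw [hcls]; dsimp only
    obtain ⟨A₁, hA₁Q, hind₁⟩ := exists_finset_of_indicator Q χ₁
    obtain ⟨A₂, hA₂Q, hind₂⟩ := exists_finset_of_indicator Q χ₂
    have hAχ₁ : As χ₁ = A₁ := hAs_eq χ₁ hA₁Q hind₁
    have hAχ₂ : As χ₂ = A₂ := hAs_eq χ₂ hA₂Q hind₂
    have hp₁ : ∏ i ∈ A₁, (i : ℚ) ≠ 0 := hAχ₁ ▸ hprod χ₁
    have hp₂ : ∏ i ∈ A₂, (i : ℚ) ≠ 0 := hAχ₂ ▸ hprod χ₂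
    -- parities of the supports
    have rsA := rowsum_Qa Q p₀ hQ hQ4 hk hQa
    have rsB := rowsum_Qb Q p₀ hQ hQ4 hk hQb
    obtain ⟨hc₁, hc₂⟩ := zmod2_par_supports ε σ (∑ i : Q, χ₁ i) (∑ i : Q, χ₂ i)
      (by linear_combination (norm := (ring_nf; reduce_mod_char)) rsA + hPa)
      (by linear_combination (norm := (ring_nf; reduce_mod_char)) rsB + hPb + hinf)
    rw [hAs_card χ₁, hAχ₁] at hc₁
    rw [hAs_card χ₂, hAχ₂] at hc₂
    -- the raw rows via the bridge
    have eχ₁ : χ₁ = fun i : Q => if (i : ℕ) ∈ A₁ then (1 : ZMod 2) else 0 := funext hind₁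
    have eχ₂ : χ₂ = fun i : Q => if (i : ℕ) ∈ A₂ then (1 : ZMod 2) else 0 := funext hind₂
    subst eχ₁ eχ₂
    obtain ⟨hrows, hPa', hPb', hinf'⟩ :=
      (sysC1_iff_rawRows Q p₀ ε σ τ₁ τ₂ γ₁ γ₂ hA₁Q hA₂Q).mp ⟨hQa, hQb, hPa, hPb, hinf⟩
    -- the bits of the base units `W σ · t(τ)`
    obtain ⟨hWpar, hWQ, hWp, hWs⟩ := hWbits σ
    obtain ⟨-, hTsel, hTpar, hTQ, hTp1, hTp2, hTs1, hTs2⟩ := hT τ₁ τ₂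
    obtain ⟨-, hX1par, hX1p, hX1Q, hX1p₀, hX1s⟩ := hX γ₁
    obtain ⟨-, hX2par, hX2p, hX2Q, hX2p₀, hX2s⟩ := hX γ₂
    have hBpar : ∀ ℓ : ℕ, (hℓ : ℓ.Prime) → ℓ ∉ S → haveI : Fact ℓ.Prime := ⟨hℓ⟩;
        parityBit ℓ ((W₁ σ * T₁ τ₁ τ₂ : ℚˣ) : ℚ) = 0 ∧ parityBit ℓ ((W₂ σ * T₂ τ₁ τ₂ : ℚˣ) : ℚ) = 0 := by
      intro ℓ hℓ hℓS; haveI : Fact ℓ.Prime := ⟨hℓ⟩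
      rw [Units.val_mul, Units.val_mul, parityBit_mul (W₁ σ).ne_zero (T₁ τ₁ τ₂).ne_zero,
        parityBit_mul (W₂ σ).ne_zero (T₂ τ₁ τ₂).ne_zero, (hWpar ℓ hℓ hℓS).1, (hWpar ℓ hℓ hℓS).2, (hTpar ℓ hℓ hℓS).1,
        (hTpar ℓ hℓ hℓS).2, add_zero]
      exact ⟨rfl, rfl⟩
    have hBQ : ∀ j ∈ Q, (hj : j.Prime) → haveI : Fact j.Prime := ⟨hj⟩;
        qrBit j ((W₁ σ * T₁ τ₁ τ₂ : ℚˣ) : ℚ) = τ₁ + ε * τ₂ ∧ qrBit j ((W₂ σ * T₂ τ₁ τ₂ : ℚˣ) : ℚ) = (1 + ε) * τ₁ + τ₂ := by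
      intro j hj hjp; haveI : Fact j.Prime := ⟨hjp⟩
      rw [Units.val_mul, Units.val_mul, qrBit_mul j (W₁ σ).ne_zero (T₁ τ₁ τ₂).ne_zero,
        qrBit_mul j (W₂ σ).ne_zero (T₂ τ₁ τ₂).ne_zero, (hWQ j hj hjp).1, (hWQ j hj hjp).2, (hTQ j hj hjp).1, (hTQ j hj hjp).2,
        zero_add, zero_add]
      exact ⟨rfl, rfl⟩
    have hBp : qrBit p₀ ((W₁ σ * T₁ τ₁ τ₂ : ℚˣ) : ℚ) = σ ∧ qrBit p₀ ((W₂ σ * T₂ τ₁ τ₂ : ℚˣ) : ℚ) = τ₁ + τ₂ := by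
      rw [Units.val_mul, Units.val_mul, qrBit_mul p₀ (W₁ σ).ne_zero (T₁ τ₁ τ₂).ne_zero,
        qrBit_mul p₀ (W₂ σ).ne_zero (T₂ τ₁ τ₂).ne_zero, hWp.1, hWp.2, hTp1, hTp2, add_zero, zero_add]
      exact ⟨rfl, rfl⟩
    have hBs : signBit ((W₁ σ * T₁ τ₁ τ₂ : ℚˣ) : ℚ) = σ ∧ signBit ((W₂ σ * T₂ τ₁ τ₂ : ℚˣ) : ℚ) = τ₁ + τ₂ := by
      rw [Units.val_mul, Units.val_mul, signBit_mul (W₁ σ).ne_zero (T₁ τ₁ τ₂).ne_zero,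
        signBit_mul (W₂ σ).ne_zero (T₂ τ₁ τ₂).ne_zero, hWs.1, hWs.2, hTs1, hTs2, add_zero, zero_add]
      exact ⟨rfl, rfl⟩
    have hBrel : ∀ v : HeightOneSpectrum (𝓞 ℚ), natGenerator v ∈ S →
        E.twoDescentClass h ((W₁ σ * T₁ τ₁ τ₂) * Units.mk0 _ hp₁) ((W₂ σ * T₂ τ₁ τ₂) * Units.mk0 _ hp₂) ∈
          selmerLocalKer E (v.adicCompletion ℚ) 2 := by
      intro v hvS
      rw [mul_right_comm (W₁ σ), mul_right_comm (W₂ σ), twoDescentClass_mul]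
      exact add_mem (hWrel σ A₁ A₂ hA₁Q hA₂Q hc₁ hc₂ hp₁ hp₂ v hvS) (((mem_selmerGroup_iff _ _ _).mp hTsel).1 v)
    have key := twist_mem_selmerGroup_param E S Q h h2S h12 h23 hgood hN hQ hQS hQ4 hk hiso8 hisoS hadm hε hp₀S hp₀Q hp8
      hsplitp hres₀4 hd (W₁ σ * T₁ τ₁ τ₂) (W₂ σ * T₂ τ₁ τ₂) (X γ₁) (X γ₂) hA₁Q hA₂Q hp₁ hp₂ hBpar hBQ hBp hBs hBrel
      ⟨hXv γ₁, hXv γ₂⟩ (fun ℓ hℓ hℓp => ⟨hX1par ℓ hℓ hℓp, hX2par ℓ hℓ hℓp⟩) ⟨hX1p, hX2p⟩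
      (fun j hj hjp => ⟨hX1Q j hj hjp, hX2Q j hj hjp⟩) ⟨hX1p₀, hX2p₀⟩ ⟨hX1s, hX2s⟩ hrows hPa' hPb' hinf'
    have hU₁ : (W₁ σ * Units.mk0 _ (hprod (fun i : Q => if (i : ℕ) ∈ A₁ then (1 : ZMod 2) else 0))) * (T₁ τ₁ τ₂ * X γ₁) =
        ((W₁ σ * T₁ τ₁ τ₂) * Units.mk0 _ hp₁) * X γ₁ :=
      Units.ext (by simp only [Units.val_mul, Units.val_mk0, hAχ₁]; ring)
    have hU₂ : (W₂ σ * Units.mk0 _ (hprod (fun i : Q => if (i : ℕ) ∈ A₂ then (1 : ZMod 2) else 0))) * (T₂ τ₁ τ₂ * X γ₂) =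
        ((W₂ σ * T₂ τ₁ τ₂) * Units.mk0 _ hp₂) * X γ₂ :=
      Units.ext (by simp only [Units.val_mul, Units.val_mk0, hAχ₂]; ring)
    rw [hU₁, hU₂]; exact key
  -- (2) injectivity
  have hinj : ∀ x x', cls x = cls x' → x = x' := by
    rintro ⟨⟨σ, τ₁, τ₂, γ₁, γ₂⟩, ⟨χ₁, χ₂⟩⟩ ⟨⟨σ', τ₁', τ₂', γ₁', γ₂'⟩, ⟨χ₁', χ₂'⟩⟩ heq
    rw [hcls, hcls] at heq; dsimp only at heq
    have k1 := (E.quadraticTwist d).kummerEquiv_twoTorsionCharH1_twoDescentClass h'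
      ((W₁ σ * Units.mk0 _ (hprod χ₁)) * (T₁ τ₁ τ₂ * X γ₁)) ((W₂ σ * Units.mk0 _ (hprod χ₂)) * (T₂ τ₁ τ₂ * X γ₂))
    have k2 := (E.quadraticTwist d).kummerEquiv_twoTorsionCharH1_swap_twoDescentClass h'
      ((W₁ σ * Units.mk0 _ (hprod χ₁)) * (T₁ τ₁ τ₂ * X γ₁)) ((W₂ σ * Units.mk0 _ (hprod χ₂)) * (T₂ τ₁ τ₂ * X γ₂))
    rw [heq, (E.quadraticTwist d).kummerEquiv_twoTorsionCharH1_twoDescentClass h'] at k1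
    rw [heq, (E.quadraticTwist d).kummerEquiv_twoTorsionCharH1_swap_twoDescentClass h'] at k2
    have hc₁ := (Additive.ofMul.injective k1).symm
    have hc₂ := (Additive.ofMul.injective k2).symm
    obtain ⟨bQ, bp, -, bs, -, bq, -⟩ := hUbits σ τ₁ τ₂ γ₁ χ₁
    obtain ⟨bQ2, -, bp2, -, bs2, -, bq2⟩ := hUbits σ τ₁ τ₂ γ₂ χ₂
    obtain ⟨bQ', bp', -, bs', -, bq', -⟩ := hUbits σ' τ₁' τ₂' γ₁' χ₁'
    obtain ⟨bQ2', -, bp2', -, bs2', -, bq2'⟩ := hUbits σ' τ₁' τ₂' γ₂' χ₂'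
    have hχ₁ : χ₁ = χ₁' := funext fun j => by
      haveI : Fact (j : ℕ).Prime := ⟨hQ j j.2⟩
      rw [← (bQ j).1, ← (bQ' j).1]; exact parityBit_eq_of_mk_eq _ hc₁
    have hχ₂ : χ₂ = χ₂' := funext fun j => by
      haveI : Fact (j : ℕ).Prime := ⟨hQ j j.2⟩
      rw [← (bQ2 j).2, ← (bQ2' j).2]; exact parityBit_eq_of_mk_eq _ hc₂
    have hγ₁ : γ₁ = γ₁' := by rw [← bp, ← bp']; exact parityBit_eq_of_mk_eq p₀ hc₁
    have hγ₂ : γ₂ = γ₂' := by rw [← bp2, ← bp2']; exact parityBit_eq_of_mk_eq p₀ hc₂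
    subst hχ₁ hχ₂ hγ₁ hγ₂
    have hσ : σ = σ' := zmod2_cancel σ σ' γ₁ (by rw [← bs, ← bs']; exact signBit_eq_of_mk_eq hc₁)
    subst hσ
    have e1 : τ₁ + ε * τ₂ + γ₁ * (if jacobiSym (-(p₀ : ℤ)) q₀ = -1 then (1 : ZMod 2) else 0) + qrBit q₀ (∏ i ∈ As χ₁, (i : ℚ)) =
        τ₁' + ε * τ₂' + γ₁ * (if jacobiSym (-(p₀ : ℤ)) q₀ = -1 then (1 : ZMod 2) else 0) + qrBit q₀ (∏ i ∈ As χ₁, (i : ℚ)) := by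
      rw [← bq, ← bq']; exact qrBit_eq_of_mk_eq q₀ hc₁
    have e2 : (1 + ε) * τ₁ + τ₂ + γ₂ * (if jacobiSym (-(p₀ : ℤ)) q₀ = -1 then (1 : ZMod 2) else 0) + qrBit q₀ (∏ i ∈ As χ₂, (i : ℚ)) =
        (1 + ε) * τ₁' + τ₂' + γ₂ * (if jacobiSym (-(p₀ : ℤ)) q₀ = -1 then (1 : ZMod 2) else 0) +
          qrBit q₀ (∏ i ∈ As χ₂, (i : ℚ)) := by
      rw [← bq2, ← bq2']; exact qrBit_eq_of_mk_eq q₀ hc₂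
    obtain ⟨hτ₁, hτ₂⟩ := zmod2_tau ε τ₁ τ₂ τ₁' τ₂' (by linear_combination e1) (by linear_combination e2)
    subst hτ₁ hτ₂
    rfl
  -- (3) surjectivity
  have hsurj : ∀ c ∈ selmerGroup (E.quadraticTwist d) 2, ∃ x, Sys x ∧ cls x = c := by
    intro c hc
    obtain ⟨a, b, ha, hb⟩ := exists_components (E.quadraticTwist d) h' c
    obtain ⟨σ, τ₁, τ₂, γa, γb, Qa, Qb, t₁, t₂, hQaQ, hQbQ, hτv, ⟨hpa, hpb, Xa, Xb, hXa, hXb, hcla, hclb⟩, hrows, hPa, hPb,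
      hinf⟩ := exists_param_of_mem_selmerGroup E S Q h h12 h23 hS h2S hgood hN hrank hsha hQ hQS hQ4 hk hq₀ hiso8 hisoS hadm
        hε hp₀S hp₀Q hp8 hsplitp ⟨r21, r31, r32⟩ w₁ w₂ hwpar hwres ⟨hws₁, hws₂⟩ hwrel hd hc a b ha hb
    refine ⟨((σ, τ₁, τ₂, γa, γb), (fun i : Q => if (i : ℕ) ∈ Qa then (1 : ZMod 2) else 0,
      fun i : Q => if (i : ℕ) ∈ Qb then (1 : ZMod 2) else 0)),
      (sysC1_iff_rawRows Q p₀ ε σ τ₁ τ₂ γa γb hQaQ hQbQ).mpr ⟨hrows, hPa, hPb, hinf⟩, ?_⟩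
    rw [hcls]; dsimp only
    obtain ⟨hT₁e, hT₂e⟩ := hTeq τ₁ τ₂ t₁ t₂ hτv
    have hAa : As (fun i : Q => if (i : ℕ) ∈ Qa then (1 : ZMod 2) else 0) = Qa := hAs_eq _ hQaQ fun i => rfl
    have hAb : As (fun i : Q => if (i : ℕ) ∈ Qb then (1 : ZMod 2) else 0) = Qb := hAs_eq _ hQbQ fun i => rfl
    have hU₁ : (W₁ σ * Units.mk0 _ (hprod (fun i : Q => if (i : ℕ) ∈ Qa then (1 : ZMod 2) else 0))) * (T₁ τ₁ τ₂ * X γa) =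
        ((if σ = 1 then w₁ else 1) * Units.mk0 _ hpa) * (t₁ * Xa) := by
      rw [hW₁, hT₁e, hXeq γa Xa hXa]
      congr 2
      exact Units.ext (by simp only [Units.val_mk0, hAa])
    have hU₂ : (W₂ σ * Units.mk0 _ (hprod (fun i : Q => if (i : ℕ) ∈ Qb then (1 : ZMod 2) else 0))) * (T₂ τ₁ τ₂ * X γb) =
        ((if σ = 1 then w₂ else 1) * Units.mk0 _ hpb) * (t₂ * Xb) := by
      rw [hW₂, hT₂e, hXeq γb Xb hXb]
      congr 2
      exact Units.ext (by simp only [Units.val_mk0, hAb])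
    rw [hU₁, hU₂, ← twoDescentClass_eq_of_mk_eq (E.quadraticTwist d) h' hcla hclb]
    exact ((E.quadraticTwist d).eq_twoDescentClass_of_kummerEquiv_eq h' a b ha hb).symm
  -- (4) the count
  rw [← natCard_sysC1_eq Q p₀ hQ hQ4 hk ε]
  refine (Nat.card_congr (Equiv.ofBijective
    (fun x : {x // Sys x} => (⟨cls x.1, hmem x.1 x.2⟩ : selmerGroup (E.quadraticTwist d) 2)) ⟨?_, ?_⟩)).symm
  · intro x x' e; exact Subtype.ext (hinj _ _ (congrArg Subtype.val e))
  · rintro ⟨c, hc⟩; obtain ⟨x, hx, hxc⟩ := hsurj c hc; exact ⟨⟨x, hx⟩, Subtype.ext hxc⟩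

end Summit.BirchSwinnertonDyer.BirchSwinnertonDyer.Theorems.GenusKolyvaginAtTwo.TorsionCellSEL

end
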